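import Mathlib
import HarnessLib
import Summits.NavierStokesRegularity.NavierStokesRegularity.Theorems.LocalVelCompTubeDoorVelCompWindowRigiditySupport
import Summits.NavierStokesRegularity.NavierStokesRegularity.Theorems.PoloidalWindowDoorPoloidalWindowRigidityErtelCollapse

/-!
# Route `LocalVelCompTubeDoor` (S10, STAGED by nsreg-p1 g9), crux K2′ `VelCompWindowRigidity` — THE CRUX TEXT, proved
# (composition of the four birth-skeleton stubs, all tree/staged theorems of this seat)

Cell ns-regularity-ideate, seat p6 (route-directed support; the statement of `velCompWindowRigidity` is VERBATIM the
staged crux `…Theses.LocalVelCompTubeDoor.VelCompWindowRigidity` of route-velcomp/Route.md, so that crux closes by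
`exact` once the route is born). RIGIDITY OF TYPE-I PROFILES WITH ONE VANISHING VELOCITY COMPONENT ON A WINDOW: a profile
of the Type-I class (rate, continuity on the open slab, unit-viscosity Oseen-mild, divergence-free slices) one of whose
Cartesian velocity components `⟪v(s,·), e⟫` (`e ≠ 0` fixed) vanishes on a nonempty open set of every slice `s < 0` is
not backward-singular at the apex. Proof = the skeleton `VelCompWindowRigidity_of` with its stubs:
window ⇒ everywhere (`velComp_windowToEverywhere`), WLOG `e = e₃` (`velComp_rotate`), ERTEL COLLAPSE `v₃ ≡ 0 ⇒ ω₃ ≡ 0`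
(`…ErtelCollapse.curl_two_eq_zero_of_apply_two_eq_zero`, KNSS Lemma 2.1 + planar flux), shear triviality
(`velComp_shearTrivial`, the poloidal flat stratum).

WHAT THIS IS NOT: not a claim about Navier–Stokes regularity (Clay A) — a regularity CRITERION's profile-rigidity half
for a STAGED door route (bears_on LADDER-NS N0; rung-to-be N0-LocalTubeDoorVelComp); establishment in the cell's sense
still requires the cross-family referee PASS + independent reproduction.
-/

noncomputable section

-- the summit and its single sub-problem share the name (CONVENTIONS §1), as in every Theorems file
set_option linter.dupNamespace false

namespace Summit.NavierStokesRegularity.NavierStokesRegularity.Theorems.LocalVelCompTubeDoorVelCompWindowRigidity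

open MeasureTheory Set Function Filter Topology TopologicalSpace Metric
open scoped RealInnerProductSpace InnerProductSpace
open Literature.Analysis Literature.Analysis.FluidPDE
open Summit.NavierStokesRegularity.NavierStokesRegularity.Theorems.LocalVelCompTubeDoorVelCompWindowRigiditySupport
open Summit.NavierStokesRegularity.NavierStokesRegularity.Theorems.PoloidalWindowDoorPoloidalWindowRigidityErtelCollapse

/-- **K2′ `VelCompWindowRigidity` (the crux text, verbatim)**: a Type-I profile with one velocity component vanishing on a
nonempty open set of every slice is not backward-singular. -/
theorem velCompWindowRigidity :
    ∀ (C : ℝ) (v : ℝ → EuclideanSpace ℝ (Fin 3) → EuclideanSpace ℝ (Fin 3)), Literature.Analysis.FluidPDE.HasTypeITimeDecay C v → ContinuousOn (Function.uncurry v) (Set.Iio (0 : ℝ) ×ˢ Set.univ) → (∀ s t : ℝ, s < t → t < 0 → ∀ x, v t x = Literature.Analysis.UnboundedOperators.heatExtension (v s) (t - s) x - Literature.Analysis.FluidPDE.oseenDuhamel 1 s v v t x) → (∀ t < 0, Literature.Analysis.FluidPDE.VectorCalculus.IsDivFree (v t)) → ∀ (e : EuclideanSpace ℝ (Fin 3)),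 e ≠ 0 → (∀ s < 0, ∃ U : Set (EuclideanSpace ℝ (Fin 3)), IsOpen U ∧ U.Nonempty ∧ ∀ y ∈ U, inner ℝ (v s y) e = 0) → ¬ Literature.Analysis.FluidPDE.IsBackwardSingularPoint v 0 := by
  intro C v hrate hcont hmild hdiv e he hwin hsing
  -- window ⇒ everywhere
  have hall : ∀ s < 0, ∀ y, inner ℝ (v s y) e = 0 := velComp_windowToEverywhere hrate hcont hmild e hwin
  -- WLOG `e = e₃`
  obtain ⟨C', v', ⟨hrate', hcont', hmild', hdiv'⟩, hsing', h3⟩ :=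
    velComp_rotate hrate hcont hmild hdiv hsing he hall
  -- Ertel collapse: `v'₃ ≡ 0 ⇒ ω'₃ ≡ 0`
  have hω3 : ∀ s < 0, ∀ y, curl (v' s) y 2 = 0 :=
    curl_two_eq_zero_of_apply_two_eq_zero hrate' hcont' hmild' hdiv' h3
  -- shear triviality
  exact velComp_shearTrivial hrate' hcont' hmild' hdiv' h3 hω3 hsing'

end Summit.NavierStokesRegularity.NavierStokesRegularity.Theorems.LocalVelCompTubeDoorVelCompWindowRigidity

end
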